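import Summits.BirchSwinnertonDyer.Rank1Residual.Additive.TameBranchTwoValueCertificateJoin
import HarnessLib

/-!
# TWO NUMBERS PER PAIR at rank one, EVERY KODAIRA TYPE: the starred sign certificate in
# forced-partner currency, Schneider and the valuation identity on X4♯(G-ord)/X3♯(G-ord) from
# Delbourgo 1998 Thm 1 + 2002 (A)(B)(C) + GZK + TWO exact `p`-adic valuations (cell `b2b-bsdres`,
# sub-cell additive-p2 = X3♯(G-ord)/X4♯(G-ord), gen 28; part 3/4)

HONEST FRAMING (cell `b2b-bsdres`, run/shared/lean/b2b/bsd-rank1-residual/, verbatim in every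
file): the goal of the cell is to DELETE the COMBINATION-SHAPED residual classes of the
Birch–Swinnerton-Dyer formula for ALL analytic-rank `≤ 1` elliptic curves over `ℚ` — "full BSD
formula for every rank `≤ 1` curve in class `C`" assembled STRICTLY from published theorems — so
that the rank-`≤ 1` remainder becomes exactly the CONSTRUCTION-SHAPED classes, which are TYPED
(missing-input `Prop`s), NOT attempted. This is not "finishing BSD". Sub-cell additive-p2: the
classes X3♯(G-ord) / X4♯(G-ord) are CONSTRUCTION-SHAPED and stay so; labels / RESIDUAL-MAP marks
UNCHANGED; nothing is booked. Theorems only; the named facts enter as hypothesis binders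
(`Delbourgo1998.thm1_exists_bounded_evenMeasure` A282, `Delbourgo2002.mainTheorem` A175,
`Delbourgo2002.thmC_charIdeal_dvd_tameBranch` A227, `Delbourgo2002.mainTheorem_potMult`, GZK).
No definition, no `sorry`.

## What

Parts 1–2 (`TameBranchTwoValueLaw.lean`, `TameBranchTwoValueCertificateJoin.lean`): with `χ = ω^u` the
Teichmüller power of the SMALL exponent (`eu = p − 1`) and the plus-symbol tower bound `p^c`, TWO wild
twisted symbol sums `S(κ)`, `S(κ')` at consecutive conductors `p^{n+1+e₀}`, `p^{n+2+e₀}` lying on ONE line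
`t ∈ {1, e−1}` with a common `k`, `e·k < 2φₙ`, give `CharLamLeAt W p k` (Delbourgo 1998 Thm 1 + 2002
(C)), type-free, and decide the sign. Here:

* §6b **THE STARRED SIGN CERTIFICATE in forced-partner currency**
  (`towerBounded_forced_inv_of_thm1_of_norm_ratTwistedSymbolSum_inv_succ`): in gen 25's (G)-field /
  unit-root setting, two values on the STARRED line ⟹ the forced partner of `(χ⁻¹, ã)` is
  tower-bounded — the census's E-SIGNCERT bit on STARRED rows from `E`'s plus symbols, where gen 26's
  Stickelberger certificate can never fire; no forced partner of either character is computed.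
* §7 **RANK ONE, general locus** (`exists_schneider_rankOne_of_thm1_of_two_norm_ratTwistedSymbolSum`):
  Delbourgo 1998 Thm 1, 2002 (A)(B)(C), GZK + `χ = ω^u` + bound `p^c` + TWO values on one line with
  `k = 1` (`e < 2φ` automatic at `p ≥ 5`) ⟹ Schneider for every (B)-datum, one exists.
* §8 **CLASS FORMS**: **`ClassX4Gord.exists_schneider_rankOne_of_thm1_of_two_norm_ratTwistedSymbolSum`**
  (Drinfeld–Manin: `c = 0`; the datum is **`‖S(κ)‖^{e·φₙ} = p^{−(e+t·φₙ)}`, `‖S(κ')‖^{e·φₙ₊₁} = p^{−(e+t·φₙ₊₁)}`**,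
  i.e. `ord_p S = 1/φ + t/e` at both levels), the X3♯(G-ord) twin with the bound `p^c`, and
  **`ClassX4Gord.padicVal_identity_rankOne_of_thm1_of_two_norm_ratTwistedSymbolSum`** (Schneider,
  `#Ш[p^∞] < ∞`, `λ(fE) = 1`, `ord Ш + ord Reg_p + ord ∏c + ord ℓ = μ(fE) + 1 + 2 ord #tors`) — gen 27's
  ONE-NUMBER theorems covered the UNSTARRED rows only; these cover EVERY Kodaira type with TWO.
  Part 4 (`TameBranchTwoValueCharacterFree.lean`) lets the tree supply `χ`.

EVIDENCE (not an input; HOME/b2b-bsdres-additive-p2/gen28/TWO-VALUE-READING.md, zero compute): the four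
STARRED unit rows of the Gord_e346 window (10725e1, 11550n1, 11825i1 @5 III*; 19110bm1@7 IV*; all X3,
`c = 0` on these rows) carry `(ord_p S(κ₁), ord_p S(κ₂)) = (1/(p−1) + 1 − 1/e, 1/(p(p−1)) + 1 − 1/e)`;
the X4 starred row 11760bb1@7 (IV*) carries the `k = 3` pair. Nothing booked; labels UNCHANGED.

Not claimed: `μ`; the LOWER half; which Teichmüller power is bounded on which Kodaira type; any booking.

References: Delbourgo 1998 Thm. 1 [Delbourgo1998]; Delbourgo 2002 Thm. (A)(B)(C) [Delbourgo2002]; Lang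
Ch. 1 §2 Thm. 2.1 [Lang1990]; MTT 1986 §I.8, §I.10–I.14 [MazurTateTeitelbaum1986Invent]; [Manin1972]. -/

set_option autoImplicit false

noncomputable section

open scoped Classical MatrixGroups ModularForm NumberField

open CongruenceSubgroup IsDedekindDomain WeierstrassCurve NumberField
  Literature.NumberTheory.EllipticCurves
  Literature.NumberTheory.EllipticCurves.ModularForms
  Literature.NumberTheory.EllipticCurves.Rank1Residual
  Literature.NumberTheory.EllipticCurves.Rank1Residual.Typed
  Literature.NumberTheory.EllipticCurves.Delbourgo2002
  Summit.BirchSwinnertonDyer.Rank1Residual.X1.MuLambda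
  Summit.BirchSwinnertonDyer.Rank1Residual.X11a.LambdaNorm

namespace Summit.BirchSwinnertonDyer.Rank1Residual.Additive

namespace TwistPartner

open TameBranchOneValue TameBranchTwoValue

/-! ### §6b The starred sign certificate in forced-partner currency (gen 25/26's setting) -/

section ForcedCurrency

variable {W : WeierstrassCurve ℚ} [W.IsElliptic] [W.IsGloballyMinimal] {p : ℕ} [hp : Fact p.Prime]
  {N : ℕ} [NeZero N] {f : CuspForm (Gamma0 N) 2} {χ : MulChar (ZMod p) ℚ_[p]} {ã : ℚ_[p]}

/-- **THE STARRED SIGN CERTIFICATE, CHARACTER-FREE (forced-partner currency).** Setting of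
`towerBounded_forced_or_inv_of_thm1` (ADDITIVE, `p ≥ 5`, defect `e ∈ {3,4,6}`, (G)-field `F`, `w ∣ p`,
THE unit root `ã`), `χ = ω^u` the Teichmüller power of the SMALL exponent of order `e`, a tower bound
`p^c` of the plus symbols, and TWO even primitive `p`-power-order characters at consecutive conductors
whose twisted symbol sums lie on the STARRED line with the same `k`, `e·k < 2φₙ`. Then the forced
partner of **`(χ⁻¹, ã)`** is bounded on the tower — gen 26's Stickelberger certificate
(`towerBounded_forced_of_thm1_of_norm_ratTwistedSymbolSum`) decides the UNSTARRED rows from one value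
and can never fire on starred rows; this one decides the STARRED rows from two. NO forced partner of
either character is computed. Nothing booked. [cite: Delbourgo1998, Theorem 1 (p. 131), p. 130]
[cite: Lang1990, Ch. 1 §2 Thm. 2.1] [cite: MazurTateTeitelbaum1986Invent, §I.8, §I.10–I.14] -/
theorem towerBounded_forced_inv_of_thm1_of_norm_ratTwistedSymbolSum_inv_succ
    (hD : Delbourgo1998.thm1_exists_bounded_evenMeasure)
    (h5 : 5 ≤ p) (hadd : Addv W p) (he : semistabilityIndex W p ∈ ({3, 4, 6} : Finset ℕ))
    (hf : IsNewformOf W f)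
    {L : Type} [Field L] [NumberField L] [IsCyclotomicExtension {p} ℚ L] (F : IntermediateField ℚ L)
    (hF : ∀ w : HeightOneSpectrum (𝓞 F), (p : 𝓞 F) ∈ w.asIdeal →
      (W.baseChange F).HasGoodReductionAt w ∧ (W.baseChange F).HasUnitRootAt w)
    (w : HeightOneSpectrum (𝓞 F)) (hw : (p : 𝓞 F) ∈ w.asIdeal)
    (hã : ‖ã‖ = 1) (hroot : ã ^ 2 - (((W.baseChange F).frobeniusTraceAt w : ℤ) : ℚ_[p]) * ã + p = 0)
    (hχe : orderOf χ = semistabilityIndex W p) {u : ℕ} (hu : semistabilityIndex W p * u = p - 1)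
    (hteich : ∀ a : ZMod p, a ≠ 0 → ‖χ a - ((a.val : ℕ) : ℚ_[p]) ^ u‖ < 1) {c : ℕ}
    (hc : ∀ (m : ℕ) (a : ℤ), ‖((ratPlusSymbol f ((a : ℚ) / (p : ℚ) ^ m) : ℚ) : ℚ_[p])‖ ≤ (p : ℝ) ^ c)
    {n : ℕ} {κ : DirichletCharacter ℂ_[p] (p ^ (n + 1 + cyclotomicExponent p))} (hκ : κ.IsPrimitive)
    (heven : κ.Even) (hord : ∃ j : ℕ, orderOf κ = p ^ j)
    {κ' : DirichletCharacter ℂ_[p] (p ^ (n + 1 + 1 + cyclotomicExponent p))} (hκ' : κ'.IsPrimitive)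
    (heven' : κ'.Even) (hord' : ∃ j : ℕ, orderOf κ' = p ^ j) {k : ℕ}
    (hk2 : semistabilityIndex W p * k < 2 * Nat.totient (p ^ (n + 1)))
    (hval : ‖ratTwistedSymbolSum f κ‖ ^ (semistabilityIndex W p * Nat.totient (p ^ (n + 1))) =
      ((p : ℝ) ^ c) ^ (semistabilityIndex W p * Nat.totient (p ^ (n + 1))) *
        ((p : ℝ)⁻¹) ^ (semistabilityIndex W p * k +
          (semistabilityIndex W p - 1) * Nat.totient (p ^ (n + 1))))
    (hval' : ‖ratTwistedSymbolSum f κ'‖ ^ (semistabilityIndex W p * Nat.totient (p ^ (n + 1 + 1))) =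
      ((p : ℝ) ^ c) ^ (semistabilityIndex W p * Nat.totient (p ^ (n + 1 + 1))) *
        ((p : ℝ)⁻¹) ^ (semistabilityIndex W p * k +
          (semistabilityIndex W p - 1) * Nat.totient (p ^ (n + 1 + 1)))) :
    ∃ C₁ : ℝ, ∀ (m : ℕ) (a : ℤ),
      ‖forced χ⁻¹ (fun r ↦ ((ratPlusSymbol f r : ℚ) : ℚ_[p])) ã ((a : ℚ) / (p : ℚ) ^ m)‖ ≤ C₁ := by
  have h3 : 3 ≤ semistabilityIndex W p := three_le_of_mem he
  rcases towerBounded_forced_or_inv_of_thm1 hD h5 hadd he hf F hF w hw hã hroot hχe with ⟨C₀, hC₀⟩ | hbd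
  · exfalso
    have hχ1 : χ ≠ 1 := by
      intro h
      rw [h, orderOf_one] at hχe
      simp only [Finset.mem_insert, Finset.mem_singleton] at he
      omega
    have hU0 := sum_ratPlusSymbol_add_div_eq_zero_of_addv W hf hadd
    obtain ⟨B, hB, hint⟩ := exists_isTameBranchOf_of_towerBounded_forced hχ1 hã hU0 hC₀
    exact hB.false_of_norm_ratTwistedSymbolSum_pow_eq_succ hã (hint _ hc) hteich hχe h3 hu hκ heven hord
      hκ' heven' hord' hk2 hval hval'
  · exact hbd

end ForcedCurrency

/-! ### §7 Rank one: Schneider from print and TWO NUMBERS, every Kodaira type -/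

section RankOne

variable {W : WeierstrassCurve ℚ} [W.IsElliptic] [W.IsGloballyMinimal] {p : ℕ} [hp : Fact p.Prime]
  {N : ℕ} [NeZero N] {f : CuspForm (Gamma0 N) 2} {χ : MulChar (ZMod p) ℚ_[p]}

/-- At `p ≥ 5` and `e ∈ {3,4,6}`: `e·1 < 2·φ(pⁿ⁺¹)` (`φ ≥ p − 1 ≥ 4`, `e ≤ 6`). [folklore] -/
theorem mul_one_lt_two_mul_totient (h5 : 5 ≤ p) {e : ℕ} (he : e ∈ ({3, 4, 6} : Finset ℕ)) (n : ℕ) :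
    e * 1 < 2 * Nat.totient (p ^ (n + 1)) := by
  have hφ : p - 1 ≤ Nat.totient (p ^ (n + 1)) := by
    rw [Nat.totient_prime_pow_succ hp.out]
    exact Nat.le_mul_of_pos_left _ (pow_pos hp.out.pos n)
  simp only [Finset.mem_insert, Finset.mem_singleton] at he
  rcases he with rfl | rfl | rfl <;> omega

/-- **`ord_{s=1}L(E,s) = 1`: Schneider for Delbourgo's datum FROM PRINT AND TWO NUMBERS, EVERY KODAIRA
TYPE** (general locus: `p ≥ 5`, ADDITIVE, (G)-ordinary, non-CM, `e ∈ {3,4,6}`): Delbourgo 1998 Thm 1,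
2002 (A)(B)(C), GZK + `χ = ω^u` of order `e` + the plus-symbol bound `p^c` + TWO even primitive
`p`-power-order characters `κ`, `κ'` of conductors `p^{n+1+e₀}`, `p^{n+2+e₀}` whose twisted symbol sums
lie on ONE line `t ∈ {1, e−1}` with `k = 1`: **`‖S(κ)‖^{e·φₙ} = (p^c)^{e·φₙ}·p^{−(e+t·φₙ)}`**,
**`‖S(κ')‖^{e·φₙ₊₁} = (p^c)^{e·φₙ₊₁}·p^{−(e+t·φₙ₊₁)}`** ⟹ Schneider's conjecture for every (B)-datum, and
one exists. Nothing booked. [cite: Delbourgo1998, Theorem 1 (p. 131)]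
[cite: Delbourgo2002, Theorem (A), (B), (C) (p. 40)] [cite: Lang1990, Ch. 1 §2 Thm. 2.1] -/
theorem exists_schneider_rankOne_of_thm1_of_two_norm_ratTwistedSymbolSum
    (hD : Delbourgo1998.thm1_exists_bounded_evenMeasure)
    (hC : Delbourgo2002.thmC_charIdeal_dvd_tameBranch) (hDel : Delbourgo2002.mainTheorem)
    (hDelM : Delbourgo2002.mainTheorem_potMult) (hGZK : rank_eq_analyticRank_of_analyticRank_le_one)
    (h5 : 5 ≤ p) (hcm : ¬ W.HasCM) (hadd : Addv W p) (hGord : TypeGOrd W p)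
    (he : semistabilityIndex W p ∈ ({3, 4, 6} : Finset ℕ)) (hr : W.analyticRank = 1)
    (hf : IsNewformOf W f) (hχe : orderOf χ = semistabilityIndex W p) {u : ℕ}
    (hu : semistabilityIndex W p * u = p - 1)
    (hteich : ∀ a : ZMod p, a ≠ 0 → ‖χ a - ((a.val : ℕ) : ℚ_[p]) ^ u‖ < 1) {c : ℕ}
    (hc : ∀ (m : ℕ) (a : ℤ), ‖((ratPlusSymbol f ((a : ℚ) / (p : ℚ) ^ m) : ℚ) : ℚ_[p])‖ ≤ (p : ℝ) ^ c)
    {n : ℕ} {κ : DirichletCharacter ℂ_[p] (p ^ (n + 1 + cyclotomicExponent p))} (hκ : κ.IsPrimitive)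
    (heven : κ.Even) (hord : ∃ j : ℕ, orderOf κ = p ^ j)
    {κ' : DirichletCharacter ℂ_[p] (p ^ (n + 1 + 1 + cyclotomicExponent p))} (hκ' : κ'.IsPrimitive)
    (heven' : κ'.Even) (hord' : ∃ j : ℕ, orderOf κ' = p ^ j) {t : ℕ}
    (ht : t = 1 ∨ t = semistabilityIndex W p - 1)
    (hval : ‖ratTwistedSymbolSum f κ‖ ^ (semistabilityIndex W p * Nat.totient (p ^ (n + 1))) =
      ((p : ℝ) ^ c) ^ (semistabilityIndex W p * Nat.totient (p ^ (n + 1))) *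
        ((p : ℝ)⁻¹) ^ (semistabilityIndex W p + t * Nat.totient (p ^ (n + 1))))
    (hval' : ‖ratTwistedSymbolSum f κ'‖ ^ (semistabilityIndex W p * Nat.totient (p ^ (n + 1 + 1))) =
      ((p : ℝ) ^ c) ^ (semistabilityIndex W p * Nat.totient (p ^ (n + 1 + 1))) *
        ((p : ℝ)⁻¹) ^ (semistabilityIndex W p + t * Nat.totient (p ^ (n + 1 + 1)))) :
    (∀ Dh : PAdicHeightData W p, LeadingTermClauses W p Dh → SchneiderConjecture Dh) ∧
      ∃ Dh : PAdicHeightData W p, LeadingTermClauses W p Dh ∧ SchneiderConjecture Dh := by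
  have hk2 := mul_one_lt_two_mul_totient h5 he n
  have hlam1 : CharLamLeAt W p 1 :=
    charLamLeAt_of_thm1_of_thmC_of_two_norm_ratTwistedSymbolSum hD hC hDel hDelM h5 hcm hadd hGord he hf
      hχe hu hteich hc hκ heven hord hκ' heven' hord' ht hk2 (by rw [mul_one]; exact hval)
      (by rw [mul_one]; exact hval')
  obtain ⟨hmw, -⟩ := hGZK W (by rw [hr])
  have hr1 : W.mordellWeilRank = 1 := by rw [hmw, hr]
  have hlam : CharLamLeAt W p W.mordellWeilRank := by rw [hr1]; exact hlam1
  have hA : ∀ (κ₁ : ZpExtension ℚ p) (γ : Field.absoluteGaloisGroup ℚ),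
      κ₁.IsCyclotomic → κ₁.IsTopGenerator γ → ∀ D : W.SelmerDualData κ₁ γ, D.IsTorsion :=
    fun _ _ hκ₁ hγ D ↦ Delbourgo2002.mainTheorem.isTorsion hDel h5 hcm hadd hGord hκ₁ hγ D
  have hS : ∀ Dh : PAdicHeightData W p, LeadingTermClauses W p Dh → SchneiderConjecture Dh :=
    fun Dh hBcl ↦ (schneider_and_finite_of_charLamLe W p hBcl hA hlam).1
  obtain ⟨Dh, hBcl⟩ := Delbourgo2002.mainTheorem.exists_leadingTermClauses hDel h5 hcm hadd hGord
  exact ⟨hS, Dh, hBcl, hS Dh hBcl⟩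

end RankOne


/-! ### §8 Class forms: X4♯(G-ord) and X3♯(G-ord) at rank one from TWO NUMBERS, every Kodaira type -/

section Classes

variable {W : WeierstrassCurve ℚ} [W.IsElliptic] [W.IsGloballyMinimal] {p : ℕ} [hp : Fact p.Prime]
  {N : ℕ} [NeZero N] {f : CuspForm (Gamma0 N) 2} {χ : MulChar (ZMod p) ℚ_[p]}

/-- **X4♯(G-ord), defect 3, 4, 6, `ord_{s=1}L(E,s) = 1`, `p ≥ 5`, non-CM, EVERY KODAIRA TYPE — SCHNEIDER
FROM PRINTED FACTS AND TWO NUMBERS.** Printed: Delbourgo 1998 Thm. 1; Delbourgo 2002 (A), (B), (C); GZK;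
Drinfeld–Manin integrality on X4 (`c = 0`). Per pair: a character `χ = ω^u` of `ℤ/p` of order
`e = semistabilityIndex W p` (`eu = p − 1`; a finite check on `χ`) and TWO even primitive `p`-power-order
characters `κ`, `κ'` of conductors `p^{n+1+e₀}`, `p^{n+2+e₀}` with **`‖Σ_b κ(b)[b/p^{n+1+e₀}]⁺_f‖_p^{e·φₙ} =
p^{−(e + t·φₙ)}`** and **`‖Σ_b κ'(b)[b/p^{n+2+e₀}]⁺_f‖_p^{e·φₙ₊₁} = p^{−(e + t·φₙ₊₁)}`** for ONE `t ∈ {1, e−1}`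
(`ord_p S = 1/φ + 1/e` at both levels — unstarred line — or `1/φ + 1 − 1/e` at both — starred line).
Then Schneider's conjecture holds for every (B)-datum. NO (G)-field, NO unit root, NO sign certificate, NO
Riemann sum, NO Kodaira-type input (gen 27's one-number theorem needed the row to be unstarred). EVIDENCE
(not an input): the starred-line datum at `k = 3` (`CharLamLeAt W 7 3`) is met on the X4 row 11760bb1@7
(IV*: `(7/6, 31/42)` at `7²`, `7³`); at `k = 1` on the four starred X3 window rows. Nothing booked;
X4♯(G-ord) stays CONSTRUCTION-SHAPED. [cite: Delbourgo1998, Theorem 1 (p. 131)]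
[cite: Delbourgo2002, Theorem (A), (B), (C) (p. 40)] [cite: Manin1972, Cor. 3.6]
[cite: Lang1990, Ch. 1 §2 Thm. 2.1] -/
theorem ClassX4Gord.exists_schneider_rankOne_of_thm1_of_two_norm_ratTwistedSymbolSum
    (hD : Delbourgo1998.thm1_exists_bounded_evenMeasure)
    (hC : Delbourgo2002.thmC_charIdeal_dvd_tameBranch) (hDel : Delbourgo2002.mainTheorem)
    (hDelM : Delbourgo2002.mainTheorem_potMult) (hGZK : rank_eq_analyticRank_of_analyticRank_le_one)
    (hX : ClassX4Gord W p) (h5 : 5 ≤ p) (hcm : ¬ W.HasCM)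
    (he : semistabilityIndex W p ∈ ({3, 4, 6} : Finset ℕ)) (hr : W.analyticRank = 1)
    (hf : IsNewformOf W f) (hχe : orderOf χ = semistabilityIndex W p) {u : ℕ}
    (hu : semistabilityIndex W p * u = p - 1)
    (hteich : ∀ a : ZMod p, a ≠ 0 → ‖χ a - ((a.val : ℕ) : ℚ_[p]) ^ u‖ < 1)
    {n : ℕ} {κ : DirichletCharacter ℂ_[p] (p ^ (n + 1 + cyclotomicExponent p))} (hκ : κ.IsPrimitive)
    (heven : κ.Even) (hord : ∃ j : ℕ, orderOf κ = p ^ j)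
    {κ' : DirichletCharacter ℂ_[p] (p ^ (n + 1 + 1 + cyclotomicExponent p))} (hκ' : κ'.IsPrimitive)
    (heven' : κ'.Even) (hord' : ∃ j : ℕ, orderOf κ' = p ^ j) {t : ℕ}
    (ht : t = 1 ∨ t = semistabilityIndex W p - 1)
    (hval : ‖ratTwistedSymbolSum f κ‖ ^ (semistabilityIndex W p * Nat.totient (p ^ (n + 1))) =
      ((p : ℝ)⁻¹) ^ (semistabilityIndex W p + t * Nat.totient (p ^ (n + 1))))
    (hval' : ‖ratTwistedSymbolSum f κ'‖ ^ (semistabilityIndex W p * Nat.totient (p ^ (n + 1 + 1))) =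
      ((p : ℝ)⁻¹) ^ (semistabilityIndex W p + t * Nat.totient (p ^ (n + 1 + 1)))) :
    (∀ Dh : PAdicHeightData W p, LeadingTermClauses W p Dh → SchneiderConjecture Dh) ∧
      ∃ Dh : PAdicHeightData W p, LeadingTermClauses W p Dh ∧ SchneiderConjecture Dh := by
  have hc : ∀ (m : ℕ) (a : ℤ),
      ‖((ratPlusSymbol f ((a : ℚ) / (p : ℚ) ^ m) : ℚ) : ℚ_[p])‖ ≤ (p : ℝ) ^ (0 : ℕ) := fun m a ↦ by
    rw [pow_zero]
    exact plusSymbolsPIntegralAt_of_classX4 W p hX.1 f hf _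
  exact TwistPartner.exists_schneider_rankOne_of_thm1_of_two_norm_ratTwistedSymbolSum hD hC hDel hDelM
    hGZK h5 hcm hX.addv.2 hX.typeGOrd he hr hf hχe hu hteich hc hκ heven hord hκ' heven' hord' ht
    (by rw [pow_zero, one_pow, one_mul]; exact hval) (by rw [pow_zero, one_pow, one_mul]; exact hval')

/-- **X3♯(G-ord), defect 3, 4, 6, `ord_{s=1}L(E,s) = 1`, `p ≥ 5`, non-CM, every Kodaira type** — the twin
with the tower bound `p^c` of the plus symbols: printed facts + `χ = ω^u` + TWO values on one line
`t ∈ {1, e−1}` with `k = 1` ⟹ Schneider for Delbourgo's datum. EVIDENCE (not an input): met with `c = 0`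
on the starred X3 window rows 10725e1, 11550n1, 11825i1 @5 (III*: `(1, 4/5)` at `5²`, `5³`) and
19110bm1@7 (IV*: `(5/6, 29/42)`). Nothing booked; X3♯(G-ord) CONSTRUCTION-SHAPED.
[cite: Delbourgo1998, Theorem 1 (p. 131)] [cite: Delbourgo2002, Theorem (A), (B), (C) (p. 40)]
[cite: Lang1990, Ch. 1 §2 Thm. 2.1] -/
theorem ClassX3Gord.exists_schneider_rankOne_of_thm1_of_two_norm_ratTwistedSymbolSum
    (hD : Delbourgo1998.thm1_exists_bounded_evenMeasure)
    (hC : Delbourgo2002.thmC_charIdeal_dvd_tameBranch) (hDel : Delbourgo2002.mainTheorem)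
    (hDelM : Delbourgo2002.mainTheorem_potMult) (hGZK : rank_eq_analyticRank_of_analyticRank_le_one)
    (hX : ClassX3Gord W p) (h5 : 5 ≤ p) (hcm : ¬ W.HasCM)
    (he : semistabilityIndex W p ∈ ({3, 4, 6} : Finset ℕ)) (hr : W.analyticRank = 1)
    (hf : IsNewformOf W f) (hχe : orderOf χ = semistabilityIndex W p) {u : ℕ}
    (hu : semistabilityIndex W p * u = p - 1)
    (hteich : ∀ a : ZMod p, a ≠ 0 → ‖χ a - ((a.val : ℕ) : ℚ_[p]) ^ u‖ < 1) {c : ℕ}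
    (hc : ∀ (m : ℕ) (a : ℤ), ‖((ratPlusSymbol f ((a : ℚ) / (p : ℚ) ^ m) : ℚ) : ℚ_[p])‖ ≤ (p : ℝ) ^ c)
    {n : ℕ} {κ : DirichletCharacter ℂ_[p] (p ^ (n + 1 + cyclotomicExponent p))} (hκ : κ.IsPrimitive)
    (heven : κ.Even) (hord : ∃ j : ℕ, orderOf κ = p ^ j)
    {κ' : DirichletCharacter ℂ_[p] (p ^ (n + 1 + 1 + cyclotomicExponent p))} (hκ' : κ'.IsPrimitive)
    (heven' : κ'.Even) (hord' : ∃ j : ℕ, orderOf κ' = p ^ j) {t : ℕ}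
    (ht : t = 1 ∨ t = semistabilityIndex W p - 1)
    (hval : ‖ratTwistedSymbolSum f κ‖ ^ (semistabilityIndex W p * Nat.totient (p ^ (n + 1))) =
      ((p : ℝ) ^ c) ^ (semistabilityIndex W p * Nat.totient (p ^ (n + 1))) *
        ((p : ℝ)⁻¹) ^ (semistabilityIndex W p + t * Nat.totient (p ^ (n + 1))))
    (hval' : ‖ratTwistedSymbolSum f κ'‖ ^ (semistabilityIndex W p * Nat.totient (p ^ (n + 1 + 1))) =
      ((p : ℝ) ^ c) ^ (semistabilityIndex W p * Nat.totient (p ^ (n + 1 + 1))) *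
        ((p : ℝ)⁻¹) ^ (semistabilityIndex W p + t * Nat.totient (p ^ (n + 1 + 1)))) :
    (∀ Dh : PAdicHeightData W p, LeadingTermClauses W p Dh → SchneiderConjecture Dh) ∧
      ∃ Dh : PAdicHeightData W p, LeadingTermClauses W p Dh ∧ SchneiderConjecture Dh :=
  TwistPartner.exists_schneider_rankOne_of_thm1_of_two_norm_ratTwistedSymbolSum hD hC hDel hDelM hGZK h5
    hcm hX.addv hX.typeGOrd he hr hf hχe hu hteich hc hκ heven hord hκ' heven' hord' ht hval hval'

/-- **X4♯(G-ord), defect 3, 4, 6, `rank E(ℚ) = 1`, `p ≥ 5`, non-CM, every Kodaira type — THE VALUATION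
IDENTITY FROM PRINTED FACTS AND TWO NUMBERS** (Delbourgo 1998 Thm 1; Delbourgo 2002 (A), (B), (C);
Drinfeld–Manin on X4; `χ = ω^u` of order `e`; TWO values on one line `t ∈ {1, e−1}` with `k = 1`): for
every (B)-datum `Dh` and every Pontryagin-dual datum with `char = (fE)`: Schneider, `#Ш[p^∞] < ∞`,
`λ(fE) = 1`, and `ord Ш[p^∞] + ord Reg_p(Dh) + ord ∏c + ord ℓ = μ(fE) + 1 + 2 ord #E(ℚ)_tors`, `ℓ ∣ p²`,
`ℓ = 1` off the anomalous rows. Nothing booked. [cite: Delbourgo1998, Theorem 1 (p. 131)]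
[cite: Delbourgo2002, Theorem (A), (B), (C) (p. 40)] [cite: Manin1972, Cor. 3.6] [cite: Lang1990, Ch. 1 §2 Thm. 2.1] -/
theorem ClassX4Gord.padicVal_identity_rankOne_of_thm1_of_two_norm_ratTwistedSymbolSum
    (hD : Delbourgo1998.thm1_exists_bounded_evenMeasure)
    (hC : Delbourgo2002.thmC_charIdeal_dvd_tameBranch) (hDel : Delbourgo2002.mainTheorem)
    (hDelM : Delbourgo2002.mainTheorem_potMult) (hX : ClassX4Gord W p) (h5 : 5 ≤ p) (hcm : ¬ W.HasCM)
    (he : semistabilityIndex W p ∈ ({3, 4, 6} : Finset ℕ)) (hrk : W.mordellWeilRank = 1)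
    (hf : IsNewformOf W f) (hχe : orderOf χ = semistabilityIndex W p) {u : ℕ}
    (hu : semistabilityIndex W p * u = p - 1)
    (hteich : ∀ a : ZMod p, a ≠ 0 → ‖χ a - ((a.val : ℕ) : ℚ_[p]) ^ u‖ < 1)
    {n : ℕ} {κ : DirichletCharacter ℂ_[p] (p ^ (n + 1 + cyclotomicExponent p))} (hκ : κ.IsPrimitive)
    (heven : κ.Even) (hord : ∃ j : ℕ, orderOf κ = p ^ j)
    {κ' : DirichletCharacter ℂ_[p] (p ^ (n + 1 + 1 + cyclotomicExponent p))} (hκ' : κ'.IsPrimitive)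
    (heven' : κ'.Even) (hord' : ∃ j : ℕ, orderOf κ' = p ^ j) {t : ℕ}
    (ht : t = 1 ∨ t = semistabilityIndex W p - 1)
    (hval : ‖ratTwistedSymbolSum f κ‖ ^ (semistabilityIndex W p * Nat.totient (p ^ (n + 1))) =
      ((p : ℝ)⁻¹) ^ (semistabilityIndex W p + t * Nat.totient (p ^ (n + 1))))
    (hval' : ‖ratTwistedSymbolSum f κ'‖ ^ (semistabilityIndex W p * Nat.totient (p ^ (n + 1 + 1))) =
      ((p : ℝ)⁻¹) ^ (semistabilityIndex W p + t * Nat.totient (p ^ (n + 1 + 1))))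
    {Dh : PAdicHeightData W p} (hBcl : LeadingTermClauses W p Dh)
    {K : ZpExtension ℚ p} {γ : Field.absoluteGaloisGroup ℚ}
    (hK : K.IsCyclotomic) (hγ : K.IsTopGenerator γ) (hcv : IsCyclotomicVariable p γ)
    (D : W.SelmerDualData K γ) [Module.Finite (IwasawaAlgebra p) D.X]
    {fE : IwasawaAlgebra p} (hchar : D.charIdeal = Ideal.span {fE}) :
    SchneiderConjecture Dh ∧ Finite (AddCommGroup.primaryComponent W.sha p) ∧
      X1.MuLambda.lam fE = 1 ∧
      ∃ ℓ : ℕ, ℓ ∣ p ^ 2 ∧ (ReductionNonAnomalous W p → ℓ = 1) ∧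
        (padicValNat p (Nat.card (AddCommGroup.primaryComponent W.sha p)) : ℤ) +
            (padicRegulator Dh).valuation + padicValNat p W.tamagawaProduct + padicValNat p ℓ =
          X1.MuLambda.mu fE + 1 + 2 * padicValNat p W.torsionOrder := by
  have hp2 : p ≠ 2 := by omega
  have hadd : Addv W p := hX.addv.2
  have hGord : TypeGOrd W p := hX.typeGOrd
  have hc : ∀ (m : ℕ) (a : ℤ),
      ‖((ratPlusSymbol f ((a : ℚ) / (p : ℚ) ^ m) : ℚ) : ℚ_[p])‖ ≤ (p : ℝ) ^ (0 : ℕ) := fun m a ↦ by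
    rw [pow_zero]
    exact plusSymbolsPIntegralAt_of_classX4 W p hX.1 f hf _
  have hk2 := mul_one_lt_two_mul_totient h5 he n
  have hlam1 : CharLamLeAt W p 1 :=
    TwistPartner.charLamLeAt_of_thm1_of_thmC_of_two_norm_ratTwistedSymbolSum hD hC hDel hDelM h5 hcm hadd
      hGord he hf hχe hu hteich hc hκ heven hord hκ' heven' hord' ht hk2
      (by rw [pow_zero, one_pow, one_mul, mul_one]; exact hval)
      (by rw [pow_zero, one_pow, one_mul, mul_one]; exact hval')
  have hXt : D.IsTorsion := Delbourgo2002.mainTheorem.isTorsion hDel h5 hcm hadd hGord hK hγ D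
  have h := padicVal_identity_of_charLamLe W p hBcl hp2 hK hγ hcv D hXt hchar
    (by rw [hrk]; exact hlam1 K γ hK hγ hcv D fE hchar)
  rw [hrk] at h
  obtain ⟨hS, hfin, hlam, ℓ, hℓ, hna, hid⟩ := h
  exact ⟨hS, hfin, hlam, ℓ, hℓ, hna, by exact_mod_cast hid⟩

end Classes

end TwistPartner

end Summit.BirchSwinnertonDyer.Rank1Residual.Additive

end
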